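import Literature.Probability.LatticeModels.TemperleyLiebCapContract
import HarnessLib

/-!
# The snake (zigzag) identities of the planar Temperley–Lieb modules: contracting next to a freshly inserted cap is the identity («TL-CAP-SNAKE»)

Topic `Literature/Probability/LatticeModels`; a rider on `TemperleyLiebCapContract.lean` («TL-CAP-CONTRACT»: `skip`, `unskip`, `capIns j`, `contractSucc j`, `capInsL`,
`contractL`, `contractSucc_capIns` — contracting AT the inserted cap gives the pattern back). In the diagram calculus of Pearce–Rittenberg–de Gier–Nienhuis (the monoid move =
a cup over a cap) the two «zigzag» composites — insert a cap at `{j, j+1}` and then contract the NEIGHBOURING pair `{j+1, j+2}` (resp. `{j−1, j}`) — straighten to the identity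
strand. In the lineage's coordinates:

* `skip_eq_skip_of_ne_right` / `skip_eq_skip_of_ne_left` — the two order embeddings missing `{j, j+1}` and `{j+1, j+2}` (resp. `{j−1, j}`) agree off the one site where they differ;
* ★★ `LinkPattern.contractSucc_succ_capIns` — **`contractSucc (j+1) (capIns j P) = P`**; ★★ `LinkPattern.contractSucc_pred_capIns` — **`contractSucc (j−1) (capIns j P) = P`**;
* ★★ `contractL_succ_comp_capInsL` / `contractL_pred_comp_capInsL` — the linear snake identities `contractL (j±1) ∘ capInsL j = id` on the planar module (loop weight `1`
  plays no role here: no loop is closed).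

Use (lane): bookkeeping for the induction on the number of marked points in the tower calculus (HOME `FINDING-BSPAN-TOWER-IDENTITY.md` §4 (S3)/(S5′): caps inserted at one
gap and contractions at a neighbouring gap).

## References
* P. A. Pearce, V. Rittenberg, J. de Gier, B. Nienhuis, *Temperley–Lieb stochastic processes*, J. Phys. A 35 (2002) L661–L668, §2 ((monoid): the cup–cap diagram of the
  generator; (TL) `e_j e_{j±1} e_j = e_j`, of which the snake identities are the half-diagram form).

## Mathlib / tree
Tree: `TemperleyLiebCapContract.lean` (`skip`, `skip_val`, `skip_injective`, `skip_ne_castSucc/succ`, `unskip`, `unskip_val`, `skip_unskip`, `capIns_partner_castSucc/succ/skip`,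
`LinkPattern.capIns`, `contractSucc`, `skip_contract_partner`, `capInsL_single`, `contractL_single`), `TemperleyLiebLinkModule.lean` (`connectSucc_val`),
`TemperleyLiebLinkRelations.lean` (`connect_partner_partner_left/right`, `connect_partner_of_ne`), `TemperleyLiebLinkPatterns.lean` (`connect_partner_left/right`,
`partner_partner`, `partner_ne`, `partner_inj`). Mathlib: `Finsupp.lhom_ext`.
-/

namespace Literature.Probability.LatticeModels.TemperleyLieb

open Function

section Snake

variable {n : ℕ}

/-- the embeddings missing `{j, j+1}` and `{i, i+1}` with `i = j + 1` agree at every site of value `≠ j`. [cite: PearceRittenbergDeGierNienhuis2002, §2 (link diagrams)] -/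
theorem skip_eq_skip_of_ne_right (j i : Fin (n + 1)) (h : i.val = j.val + 1) {z : Fin n} (hz : z.val ≠ j.val) : skip j z = skip i z := by
  apply Fin.ext; rw [skip_val, skip_val]; split_ifs <;> omega

/-- the embeddings missing `{j, j+1}` and `{i, i+1}` with `i + 1 = j` agree at every site of value `≠ i`. [cite: PearceRittenbergDeGierNienhuis2002, §2 (link diagrams)] -/
theorem skip_eq_skip_of_ne_left (j i : Fin (n + 1)) (h : i.val + 1 = j.val) {z : Fin n} (hz : z.val ≠ i.val) : skip j z = skip i z := by
  apply Fin.ext; rw [skip_val, skip_val]; split_ifs <;> omega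

/-- ★★ **SNAKE IDENTITY, right**: inserting the cap at `{j, j+1}` and contracting the pair `{j+1, j+2}` gives the pattern back.
[cite: PearceRittenbergDeGierNienhuis2002, §2 ((monoid): the cup–cap diagram; (TL) `e_j e_{j+1} e_j = e_j`)] -/
theorem LinkPattern.contractSucc_succ_capIns (P : LinkPattern (n + 1 + 1)) (j i : Fin (n + 1 + 1 + 1)) (h : i.val = j.val + 1) :
    (P.capIns j).contractSucc i = P := by
  -- the old site `j` and its partner `y`
  have hjn : j.val < n + 1 + 1 := by have := i.2; omega
  set xj : Fin (n + 1 + 1) := ⟨j.val, hjn⟩ with hxj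
  set y := P.1.partner xj with hy
  have hyj : y.val ≠ j.val := fun e => P.1.partner_ne xj (Fin.ext (by rw [← hy]; exact e))
  -- sites of the big pattern
  have ea : Fin.castSucc i = j.succ := Fin.ext (by rw [Fin.val_castSucc, Fin.val_succ, h])
  have eb : i.succ = skip j xj := Fin.ext (by rw [Fin.val_succ, skip_val, h]; show j.val + 1 + 1 = _; rw [if_neg (by show ¬ j.val < j.val; omega)])
  set Q := (P.capIns j).1 with hQ
  have hQa : Q.partner (Fin.castSucc i) = Fin.castSucc j := by rw [ea]; exact PerfectMatching.capIns_partner_succ j P.1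
  have hQb : Q.partner i.succ = skip j y := by rw [eb]; exact PerfectMatching.capIns_partner_skip j P.1 xj
  have hab : Fin.castSucc i ≠ i.succ := (show Fin.castSucc i < i.succ from Fin.castSucc_lt_succ).ne
  -- the moved pattern
  set Q' := Q.connect (Fin.castSucc i) i.succ with hQ'
  have hQ'j : Q'.partner (Fin.castSucc j) = skip j y := by rw [← hQa, hQ', PerfectMatching.connect_partner_partner_left _ hab, hQb]
  have hQ'y : Q'.partner (skip j y) = Fin.castSucc j := by rw [← hQb, hQ', PerfectMatching.connect_partner_partner_right _ hab, hQa]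
  have hQ'other : ∀ w : Fin (n + 1 + 1 + 1 + 1), w ≠ Fin.castSucc i → w ≠ i.succ → w ≠ Fin.castSucc j → w ≠ skip j y → Q'.partner w = Q.partner w := by
    intro w h1 h2 h3 h4
    rw [hQ']
    exact PerfectMatching.connect_partner_of_ne _ h1 h2 (by rw [hQa]; exact h3) (by rw [hQb]; exact h4)
  -- compare partner functions through `skip i`
  apply Subtype.ext
  apply PerfectMatching.ext
  funext x
  apply skip_injective i
  have step : skip i (((P.capIns j).contractSucc i).1.partner x) = Q'.partner (skip i x) := by
    show skip i ((PerfectMatching.contract i ((P.capIns j).connectSucc i).1 ((P.capIns j).connectSucc_partner_castSucc i)).partner x) = _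
    rw [PerfectMatching.skip_contract_partner]
    rfl
  rw [step]
  have hQx : ∀ z : Fin (n + 1 + 1), Q.partner (skip j z) = skip j (P.1.partner z) := fun z => PerfectMatching.capIns_partner_skip j P.1 z
  -- case analysis on `x`
  by_cases hx : x = xj
  · -- the old site `j` sits at the big site `j` (= `skip i xj` since `j < i`)
    subst hx
    have e1 : skip i xj = Fin.castSucc j := Fin.ext (by rw [skip_val, Fin.val_castSucc, if_pos (by show j.val < i.val; omega)])
    rw [e1, hQ'j, ← hy]
    exact skip_eq_skip_of_ne_right j i h hyj
  · have hxv : x.val ≠ j.val := fun e => hx (Fin.ext e)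
    have e1 : skip i x = skip j x := (skip_eq_skip_of_ne_right j i h hxv).symm
    rw [e1]
    by_cases hxy : x = y
    · -- `x` is the partner of the old `j`
      rw [hxy, hQ'y]
      have : P.1.partner y = xj := by rw [hy, P.1.partner_partner]
      rw [this]
      exact Fin.ext (by rw [Fin.val_castSucc, skip_val, if_pos (by show j.val < i.val; omega)])
    · have hz : (P.1.partner x).val ≠ j.val := by
        intro e
        have : P.1.partner x = xj := Fin.ext e
        exact hxy (by rw [← P.1.partner_partner x, this])
      rw [hQ'other (skip j x) (by rw [ea]; exact skip_ne_succ j x) (by rw [eb]; exact fun e => hx (skip_injective j e))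
          (skip_ne_castSucc j x) (fun e => hxy (skip_injective j e)), hQx]
      exact skip_eq_skip_of_ne_right j i h hz

/-- ★★ **SNAKE IDENTITY, left**: inserting the cap at `{j, j+1}` and contracting the pair `{j−1, j}` gives the pattern back.
[cite: PearceRittenbergDeGierNienhuis2002, §2 ((monoid): the cup–cap diagram; (TL) `e_j e_{j−1} e_j = e_j`)] -/
theorem LinkPattern.contractSucc_pred_capIns (P : LinkPattern (n + 1 + 1)) (j i : Fin (n + 1 + 1 + 1)) (h : i.val + 1 = j.val) :
    (P.capIns j).contractSucc i = P := by
  -- the old site `j − 1 = i` and its partner `w`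
  have hin : i.val < n + 1 + 1 := by have := j.2; omega
  set xi : Fin (n + 1 + 1) := ⟨i.val, hin⟩ with hxi
  set w := P.1.partner xi with hw
  have hwi : w.val ≠ i.val := fun e => P.1.partner_ne xi (Fin.ext (by rw [← hw]; exact e))
  have ea : Fin.castSucc i = skip j xi := Fin.ext (by rw [Fin.val_castSucc, skip_val, if_pos (by show i.val < j.val; omega)])
  have eb : i.succ = Fin.castSucc j := Fin.ext (by rw [Fin.val_succ, Fin.val_castSucc, h])
  set Q := (P.capIns j).1 with hQ
  have hQa : Q.partner (Fin.castSucc i) = skip j w := by rw [ea]; exact PerfectMatching.capIns_partner_skip j P.1 xi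
  have hQb : Q.partner i.succ = j.succ := by rw [eb]; exact PerfectMatching.capIns_partner_castSucc j P.1
  have hab : Fin.castSucc i ≠ i.succ := (show Fin.castSucc i < i.succ from Fin.castSucc_lt_succ).ne
  set Q' := Q.connect (Fin.castSucc i) i.succ with hQ'
  have hQ'w : Q'.partner (skip j w) = j.succ := by rw [← hQa, hQ', PerfectMatching.connect_partner_partner_left _ hab, hQb]
  have hQ'j : Q'.partner j.succ = skip j w := by rw [← hQb, hQ', PerfectMatching.connect_partner_partner_right _ hab, hQa]
  have hQ'other : ∀ v : Fin (n + 1 + 1 + 1 + 1), v ≠ Fin.castSucc i → v ≠ i.succ → v ≠ skip j w → v ≠ j.succ → Q'.partner v = Q.partner v := by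
    intro v h1 h2 h3 h4
    rw [hQ']
    exact PerfectMatching.connect_partner_of_ne _ h1 h2 (by rw [hQa]; exact h3) (by rw [hQb]; exact h4)
  apply Subtype.ext
  apply PerfectMatching.ext
  funext x
  apply skip_injective i
  have step : skip i (((P.capIns j).contractSucc i).1.partner x) = Q'.partner (skip i x) := by
    show skip i ((PerfectMatching.contract i ((P.capIns j).connectSucc i).1 ((P.capIns j).connectSucc_partner_castSucc i)).partner x) = _
    rw [PerfectMatching.skip_contract_partner]
    rfl
  rw [step]
  have hQx : ∀ z : Fin (n + 1 + 1), Q.partner (skip j z) = skip j (P.1.partner z) := fun z => PerfectMatching.capIns_partner_skip j P.1 z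
  by_cases hx : x = xi
  · -- the old site `i` now sits at the big site `i + 2 = j + 1` (= `skip i xi`)
    subst hx
    have e1 : skip i xi = j.succ := Fin.ext (by rw [skip_val, Fin.val_succ, if_neg (by show ¬ i.val < i.val; omega)]; show i.val + 2 = j.val + 1; omega)
    rw [e1, hQ'j, ← hw]
    exact skip_eq_skip_of_ne_left j i h hwi
  · have hxv : x.val ≠ i.val := fun e => hx (Fin.ext e)
    have e1 : skip i x = skip j x := (skip_eq_skip_of_ne_left j i h hxv).symm
    rw [e1]
    by_cases hxw : x = w
    · rw [hxw, hQ'w]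
      have : P.1.partner w = xi := by rw [hw, P.1.partner_partner]
      rw [this]
      exact Fin.ext (by rw [Fin.val_succ, skip_val, if_neg (by show ¬ i.val < i.val; omega)]; show j.val + 1 = i.val + 2; omega)
    · have hz : (P.1.partner x).val ≠ i.val := by
        intro e
        have : P.1.partner x = xi := Fin.ext e
        exact hxw (by rw [← P.1.partner_partner x, this])
      rw [hQ'other (skip j x) (by rw [ea]; exact fun e => hx (skip_injective j e)) (by rw [eb]; exact skip_ne_castSucc j x)
          (fun e => hxw (skip_injective j e)) (skip_ne_succ j x), hQx]
      exact skip_eq_skip_of_ne_left j i h hz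

variable {R : Type*} [CommRing R]

/-- ★★ **the linear snake identity, right**: `contractL (j+1) ∘ capInsL j = id` on the planar module. [cite: PearceRittenbergDeGierNienhuis2002, §2 (monoid), (TL)] -/
theorem contractL_succ_comp_capInsL (j i : Fin (n + 1 + 1 + 1)) (h : i.val = j.val + 1) : contractL R i ∘ₗ capInsL R j (n := n + 1 + 1) = LinearMap.id := by
  refine Finsupp.lhom_ext fun P c => ?_
  rw [LinearMap.comp_apply, capInsL_single, contractL_single, LinkPattern.contractSucc_succ_capIns P j i h, LinearMap.id_apply]

/-- ★★ **the linear snake identity, left**: `contractL (j−1) ∘ capInsL j = id`. [cite: PearceRittenbergDeGierNienhuis2002, §2 (monoid), (TL)] -/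
theorem contractL_pred_comp_capInsL (j i : Fin (n + 1 + 1 + 1)) (h : i.val + 1 = j.val) : contractL R i ∘ₗ capInsL R j (n := n + 1 + 1) = LinearMap.id := by
  refine Finsupp.lhom_ext fun P c => ?_
  rw [LinearMap.comp_apply, capInsL_single, contractL_single, LinkPattern.contractSucc_pred_capIns P j i h, LinearMap.id_apply]

end Snake

end Literature.Probability.LatticeModels.TemperleyLieb
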